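import Summits.QuantumFields.YangMills.Theorems.BalabanUVNodesK0V19Stub2Prime
import Summits.QuantumFields.YangMills.Theorems.BalabanUVNodesK2NamedJetsRunRemAt

/-!
# K0⁷ V19 — STUB 3ᴬ′'s (j, c)-GENERIC RUN-WISE SUB-FACE 3ᴿ AND THE RUN-WISE (hcomp) ROAD TO K0⁷ BY NAME

Cell `pub-ymgap`, width seat `pub-ymgap-k0-s3-w2` (g0; director-ym R399 (3a) ∕ №207 «k0-s3-w1∕w2 → (j,c)-generic sub-faces of `stub_absBetaBoxAtThm1WitnessCCMGen13` by CLAIM»;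
bus CLAIM-1 I.29101).  `--kind proof --supports stmt-QuantumFields-20541 --as helper` (count-neutral).  NEW leaf; theorems only; 0 `def`; nothing modified; no registry write.
[15] = [Balaban1985Variational]; [6] = [Balaban1985RegularSpaces]; [I] = [Balaban1987RG1]; [II] = [Balaban1989LargeFieldII]; [III] = [Balaban1988Convergent].

WHY.  V19's registered stub 3ᴬ′ `K0V19Defs.AbsBetaBoxAtThm1WitnessCCMGenAt F` asks, at every cube letter `(j, c)` with `c ≤ L^j`, for a BOX-WIDE two-sided bound
`−β′ ≤ β₁₃(θ₁₅ᶜᶜᴹ(j)) k v ≤ β′` at EVERY scale `k` and EVERY history `v ∈ ]0, γ₀]^{k+1}` — in particular along the constant history `(γ₀, …, γ₀)` at every `k`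
(ym-nodeO P3 g51 EVIDENCE n°87 (3), `absBetaBoxGenAt_reads_constHist`): the «box-wide ∀k letter at a fixed level» shape of barrier note BN-F (N3) (CRIT-1 g4, bus I.27199:
«no box-wide-∀k-at-fixed-level stub to a prover»; [I] Thm 3 p. 264 reads β only ALONG THE RG RUNS `0 < g_k ≤ γ`).  The K0 node, however, reads 3ᴬ′ ONLY through dag-n21-c's
PART 1 `K0GenericCubeOfStepTokensR.clausesH_of_absBox` → `Node00.hcompBoth_genSeq_of_betaBoxSignFree`, and that lemma evaluates the box bound ONLY at the prefixes
`(g_0, …, g_m)` of the in-window generated run `genSeq β g₀` — i.e. along solutions of (0.20) staying in `]0, γ]`.  Hence the RUN-WISE sub-face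

  3ᴿ(F) := ∀ (j c) (B₃ B₃′ a₀ a₁), c ≤ L^j → 2L² ≤ B₃ → 0 < B₃′ → 0 < a₀ → 0 < a₁ → (8)-sentence → (9)-token at (L^j, c) →
           ∃ γ₀ ε₀ ε₂₉ β′, 0 < γ₀ ∧ 0 < ε₀ ∧ 0 < ε₂₉ ∧ RunConstRemainder (betaOfRecord₁₃ F 2 (theta13OfThm1CCM F 2 j ε₀ ε₂₉ B₃ B₃′ a₀ a₁)) (fun _ => 0) β′ γ₀

(3ᴬ′'s (j,c)-generic prefix VERBATIM; the clause = ym-nodeO P3 g51's W-R3A `NodeOWitnessRunText` over DEF-1's TREE letter `BalabanUVNodesK2NamedJetsRunRemAt.RunConstRemainder`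
(p596574 :92): `|β_{k+1}(g_0, …, g_k)| ≤ β′` at every prefix of every solution of (0.20) up to `n` staying in `]0, γ₀]`) ALREADY PAYS K0⁷ together with stubs 1 and 2′ — this file is
that road, kernel-checked, BY NAME.  3ᴬ′ ⟹ 3ᴿ (§4 `run3R_of_abs3A'`, box ⟹ runs); the converse is NOT claimed (and is what (N3) says a supplier should not be asked).  The text 3ᴿ is
DISPLAYED as a hypothesis (spelled inline, no `def`); V19 87879403b3a26109 STANDS — whether a later cut registers 3ᴿ is the plan's word, not this seat's.

CONTENTS (0 `def`, 0 `sorry`).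
§0 generic (`β : HBeta`): `rgEqH_genSeq_of_inInterval` (an in-window generated run solves (0.20)); ★ `hcompBoth_genSeq_of_runBetaBoxSignFree` — BOTH comparability clauses
   `ε_m ≤ 2ε_{m+1}`, `ε_{m+1} ≤ 2ε_m` along `genSeq β g₀` from the window `γ ≤ ½` and a two-sided bound `bₗ ≤ β_m(g_0,…,g_m) ≤ β′` READ ALONG THAT RUN ONLY, letters `−bₗ·γ² ≤ 3`,
   `β′·γ² ≤ ¾` (the run-wise twin of `Node00.hcompBoth_genSeq_of_betaBoxSignFree`, same arithmetic); `hcompBoth_genSeq_of_runConstRemainder` (the `RunConstRemainder β 0 β′ γ` form);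
   `runConstRemainder_zero_of_absBox` (box ⟹ runs), `runConstRemainder_zero_iff` (the letter unfolded), `nonneg_of_runConstRemainder_zero` (`0 ≤ β′` from the one-point run).
§1 θ-generic: `hcompBoth_of_runConstRemainder (θ : Stage13Params F N)` ⊢ (hcomp) ∧ (hcompRev) of row `bg` along every windowed run of θ from `RunConstRemainder β₁₃(θ) 0 β′ θ.γ`.
§2 at the windowed witness: `runConstRemainder_theta13OfThm1CCMW_of_half` (CCM → CCMW transfer ALONG RUNS, via A2ʷ `betaOfRecord₁₃_theta13OfThm1CCMW_eq_of_mem`),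
   ★ `hcompBoth_theta13OfThm1CCMW_of_runConstRemainder_half`.
§3 ★ `clausesH_of_runAbsBox` (PART 1 §1's twin: ONE run-wise bound of `θ₁₅ᶜᶜᴹ(j)` ⟹ the clauses at `θ₁₅ᶜᶜᴹᵂ(j; γ)`, window shrunk by `exists_window_letters_signFree`);
   ★ `exists_k0H_of_thm1CoP7M_of_gauge9R_of_runAbsBox` (PART 1 §2's twin: K0⁷'s body at `F` at the cube letter `(L^j, c)` from (8), the (9)-token and 3ᴿ's clause there).
§4 stub level: ★★ `record13SepCoPHBody_of_stub1_of_gauge9Supplier_of_runAbsBetaBoxAt` (PART 1 §3's twin), ★★ `record13SepCoPHInhabited_of_stub1_stub2P_run3R` (texts of stubs 1, 2′ and 3ᴿ ⟹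
   K0⁷ BY NAME; PART 2's supplier `gauge9Supplier_of_prop6MemberP`), ★★★ `record13SepCoPHInhabited_of_stub1_run3R_byName` (stub 2′ discharged BY NAME, p595104), `run3R_of_abs3A'`
   (3ᴬ′ ⟹ 3ᴿ at one family) and the sanity that V19's by-name composition FACTORS through 3ᴿ.

HONEST FRAMING.  Elementary real arithmetic on (0.20) and by-name compositions; every β-input is a DISPLAYED hypothesis (3ᴿ ∕ 3ᴬ′ are NODE O's wall: [I] §1 p.264 «uniformly bounded»
is STATED in print, its proof unpublished, [II] p.355); nothing of Bałaban asserted; no stub proved; K0⁷ stmt-QuantumFields-20541 OPEN (stubs 1 ∧ 3ᴬ′ active); counts unmoved (typed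
28∕28 · discharged 5∕28) — count words are the chair's.  One finite 𝕋⁴ programme at fixed `ε = L^{−K}`, Bałaban AS PRINTED — NOT continuum ∕ ℝ⁴ ∕ OS ∕ mass gap ∕ Clay: the Yang–Mills
mass gap is NOT proved by any of this; route R4 closes the CONDITIONAL finite-𝕋⁴ rung `BalabanLadder.UV` only.  No `sorry`, `def`, `instance`, `notation`, `axiom`.
-/

noncomputable section

open scoped Matrix.Norms.L2Operator

namespace Summit.QuantumFields.YangMills.Theorems.K0Stub3RunwiseFace

open Literature.MathematicalPhysics.QuantumFieldTheory.Balaban1983to89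
open Literature.MathematicalPhysics.QuantumFieldTheory.Balaban1983to89.Node00
open Literature.MathematicalPhysics.QuantumFieldTheory.Balaban1983to89.T4Continuum
open Literature.MathematicalPhysics.QuantumFieldTheory.Balaban1983to89.FlowStep
open Literature.MathematicalPhysics.QuantumFieldTheory.Balaban1983to89.FlowStepRuns
open Literature.MathematicalPhysics.QuantumFieldTheory.Balaban1983to89.B8LeafModelZd (ZdIdx)
open Summit.QuantumFields.YangMills.Theorems.BalabanUVNodesK2NamedJetsRunRemAt (RunConstRemainder)
open Summit.QuantumFields.YangMills.Theorems.K0V19Defs (Prop8StepCoPAt Prop6MemberB8AtP AbsBetaBoxAtThm1WitnessCCMGenAt K0HBodyAt)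
open Summit.QuantumFields.YangMills.Theorems.K0V19Stub2Prime (stub_prop6MemberB8AtP13)
open Summit.QuantumFields.YangMills.Theorems.K0PrintCubeOfStepTokensR (gauge9Supplier_of_prop6MemberP)
open Summit.QuantumFields.YangMills.BalabanUVNodes.N07Thm1Top7FromProp8 (variationalThm1RegSepCoP7M_of_prop8TopStep)

/-! ## §0  Generic: an in-window generated run solves (0.20); both comparability clauses along it from a bound READ ALONG THE RUN -/

section Generic

/-- **AN IN-WINDOW GENERATED RUN SOLVES (0.20)**: if `genSeq β g₀` stays in `]0, γ]` up to `n`, it is a solution of the history recursion `RGEqH n β` (each step is the positive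
branch of `solveCoupling`, `Node00.inv_sq_genSeq_succ`).  The RAW-SEQUENCE form (any `g₀`, any horizon `n`) of `B12NodeKnitIndAPlug.rgEqH_genSeq_of_inInterval` ∕
`FlowStepRuns.rgEqH_of_inInterval` (stated there over `B12.RunParams` ∕ `genFlow` ∕ a `B12.Construction`); five lines, no construction. [cite: Balaban1987RG1, (0.18)–(0.20) pp.255–256] -/
theorem rgEqH_genSeq_of_inInterval {β : HBeta} {g0 γ : ℝ} {n : ℕ} (hI : Step.InInterval γ n (genSeq β g0)) :
    RGEqH n β (genSeq β g0) := by
  intro k hk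
  have hpos : 0 < genSeq β g0 (k + 1) := (hI (k + 1) (Nat.succ_le_of_lt hk)).1
  have h := inv_sq_genSeq_succ β g0 hpos
  rw [one_div, one_div, h]
  ring

/-- **★ BOTH COMPARABILITY CLAUSES ALONG `genSeq β g₀` FROM THE WINDOW AND A TWO-SIDED β-BOUND READ ALONG THAT RUN** ([III] (2.6)–(2.8) «from the renormalization group equations (0.20)
and from the properties of the β-functions», [I] Thm 3 p.264: β is read along the runs `0 < g_k ≤ γ`): `0 < g_j ≤ γ ≤ ½` for `j ≤ n` and `bₗ ≤ β_m(g_0,…,g_m) ≤ β′` FOR `m < n` ALONG THIS RUN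
(`bₗ`, `β′` of ANY sign), letters `−bₗ·γ² ≤ 3`, `β′·γ² ≤ ¾`, `0 ≤ A₀`, `p₀ = 1` ⟹ `ε_m ≤ 2ε_{m+1}` AND `ε_{m+1} ≤ 2ε_m` for every `m < n`.  The run-wise twin of
`Node00.hcompBoth_genSeq_of_betaBoxSignFree` (node O P3 g48), whose proof reads the box at these prefixes only — same arithmetic (`le_two_mul_of_inv_sq_step_lower ∕ _upper`,
`epsOfRecord_le_two_mul_of_le_two_mul`).  CONDITIONAL on the displayed run-wise bound. [cite: Balaban1988Convergent, (2.4) p.255, (2.6)–(2.8) pp.255–256; Balaban1987RG1, (0.20) p.256, Thm 3 p.264] -/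
theorem hcompBoth_genSeq_of_runBetaBoxSignFree (ν : Stage7Numerics) (hp : ν.p₀ = 1) (hA : 0 ≤ ν.A₀) {β : HBeta} {g0 γ bl β' : ℝ} {n : ℕ}
    (hI : Step.InInterval γ n (genSeq β g0)) (hγ : γ ≤ 1 / 2)
    (hrun : ∀ m, m < n → bl ≤ β m (prefixOf (genSeq β g0) m) ∧ β m (prefixOf (genSeq β g0) m) ≤ β')
    (hl : -bl * γ ^ 2 ≤ 3) (hu : β' * γ ^ 2 ≤ 3 / 4) :
    (∀ m, m < n → epsOfRecord ν (genSeq β g0) m ≤ 2 * epsOfRecord ν (genSeq β g0) (m + 1)) ∧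
    (∀ m, m < n → epsOfRecord ν (genSeq β g0) (m + 1) ≤ 2 * epsOfRecord ν (genSeq β g0) m) := by
  have key : ∀ m, m < n → genSeq β g0 m ≤ 2 * genSeq β g0 (m + 1) ∧ genSeq β g0 (m + 1) ≤ 2 * genSeq β g0 m := by
    intro m hm
    have hgm := hI m hm.le
    have hgm' := hI (m + 1) hm
    have hβlo : bl ≤ β m (prefixOf (genSeq β g0) m) := (hrun m hm).1
    have hβup : β m (prefixOf (genSeq β g0) m) ≤ β' := (hrun m hm).2
    have hid := inv_sq_genSeq_succ β g0 hgm'.1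
    have hg2 : genSeq β g0 m ^ 2 ≤ γ ^ 2 := pow_le_pow_left₀ hgm.1.le hgm.2 2
    have hg2nn : 0 ≤ genSeq β g0 m ^ 2 := sq_nonneg _
    refine ⟨le_two_mul_of_inv_sq_step_lower (t := -bl) hgm.1 hgm'.1 (by rw [hid]; linarith) ?_,
      le_two_mul_of_inv_sq_step_upper (t := β') hgm.1 hgm'.1 (by rw [hid]; linarith) ?_⟩
    · rcases le_or_gt 0 bl with hbl | hbl
      · nlinarith [hg2nn, hbl]
      · exact (mul_le_mul_of_nonneg_left hg2 (by linarith)).trans hl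
    · rcases le_or_gt 0 β' with hb' | hb'
      · exact (mul_le_mul_of_nonneg_left hg2 hb').trans hu
      · nlinarith [hg2nn, hb']
  refine ⟨fun m hm => ?_, fun m hm => ?_⟩
  · have hgm := hI m hm.le
    have hgm' := hI (m + 1) hm
    exact epsOfRecord_le_two_mul_of_le_two_mul ν hp hA hgm.1 hgm'.1 (hgm.2.trans hγ) (hgm'.2.trans hγ) (key m hm).1
  · have hgm := hI m hm.le
    have hgm' := hI (m + 1) hm
    exact epsOfRecord_le_two_mul_of_le_two_mul ν hp hA hgm'.1 hgm.1 (hgm'.2.trans hγ) (hgm.2.trans hγ) (key m hm).2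

/-- **THE SAME FROM DEF-1's RUN-WISE LETTER ABOUT ZERO** (`RunConstRemainder β 0 β′ γ` = «`|β_{k+1}(g_0,…,g_k)| ≤ β′` at every prefix of every solution of (0.20) up to `n` staying in
`]0, γ]`», tree p596574 :92 — ym-nodeO P3 g51's W-R3A clause): the in-window generated run is such a solution (`rgEqH_genSeq_of_inInterval`), so ONE letter `β′·γ² ≤ ¾` gives both clauses
(`bₗ := −β′`, and `β′·γ² ≤ ¾ ≤ 3`).  CONDITIONAL. [cite: Balaban1987RG1, (0.20) p.256, Thm 3 p.264, (5.10) p.293; Balaban1988Convergent, (2.4)–(2.8) pp.255–256] -/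
theorem hcompBoth_genSeq_of_runConstRemainder (ν : Stage7Numerics) (hp : ν.p₀ = 1) (hA : 0 ≤ ν.A₀) {β : HBeta} {g0 γ β' : ℝ} {n : ℕ}
    (hI : Step.InInterval γ n (genSeq β g0)) (hγ : γ ≤ 1 / 2) (hR : RunConstRemainder β (fun _ => 0) β' γ) (hu : β' * γ ^ 2 ≤ 3 / 4) :
    (∀ m, m < n → epsOfRecord ν (genSeq β g0) m ≤ 2 * epsOfRecord ν (genSeq β g0) (m + 1)) ∧
    (∀ m, m < n → epsOfRecord ν (genSeq β g0) (m + 1) ≤ 2 * epsOfRecord ν (genSeq β g0) m) := by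
  have hrg : RGEqH n β (genSeq β g0) := rgEqH_genSeq_of_inInterval hI
  refine hcompBoth_genSeq_of_runBetaBoxSignFree ν hp hA hI hγ (bl := -β') (β' := β') (fun m hm => ?_) (by rw [neg_neg]; linarith) hu
  have h := hR n (genSeq β g0) hrg hI m hm.le
  rw [sub_zero] at h
  exact ⟨(abs_le.mp h).1, (abs_le.mp h).2⟩

/-- **BOX ⟹ RUNS ABOUT ZERO**: a sign-free β-box `−β′ ≤ β ≤ β′` on `]0, γ₀]` gives the run-wise letter `RunConstRemainder β 0 β′ γ₀` (the in-window prefixes lie in the box).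
The converse is NOT claimed. [cite: Balaban1987RG1, §1 (1.22) p.264 and Thm 3 p.264 (bookkeeping)] -/
theorem runConstRemainder_zero_of_absBox {β : HBeta} {γ₀ β' : ℝ} (hlow : BetaLowerH (-β') γ₀ β) (hup : BetaUpperH β' γ₀ β) :
    RunConstRemainder β (fun _ => 0) β' γ₀ := by
  intro n gs _ hI k hk
  have hv : prefixOf gs k ∈ Box γ₀ k := mem_box.mpr fun i => hI i ((Nat.lt_succ_iff.mp i.isLt).trans hk)
  rw [sub_zero, abs_le]
  exact ⟨hlow k _ hv, hup k _ hv⟩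

/-- THE LETTER ABOUT ZERO, UNFOLDED: `RunConstRemainder β 0 β′ γ₀` says exactly `|β_{k+1}(g_0, …, g_k)| ≤ β′` at every prefix `k ≤ n` of every solution `gs` of (0.20) up to `n`
staying in `]0, γ₀]` — the print-faithful reading of «uniformly bounded» ALONG THE RUNS ([I] Thm 3 p.264), with no value of β off the runs constrained. [cite: Balaban1987RG1, Thm 3 p.264 and §1 p.264] -/
theorem runConstRemainder_zero_iff {β : HBeta} {γ₀ β' : ℝ} :
    RunConstRemainder β (fun _ => 0) β' γ₀ ↔
      ∀ (n : ℕ) (gs : ℕ → ℝ), RGEqH n β gs → Step.InInterval γ₀ n gs → ∀ k, k ≤ n → |β k (prefixOf gs k)| ≤ β' := by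
  simp only [RunConstRemainder, sub_zero]

/-- A run-wise letter about zero at level `γ₀ > 0` forces `0 ≤ β′` (read it at the one-point run `(γ₀)`, `n = 0`). [folklore] -/
theorem nonneg_of_runConstRemainder_zero {β : HBeta} {γ₀ β' : ℝ} (hγ₀ : 0 < γ₀) (hR : RunConstRemainder β (fun _ => 0) β' γ₀) : 0 ≤ β' := by
  have h := hR 0 (fun _ => γ₀) (fun k hk => absurd hk (Nat.not_lt_zero k)) (fun _ _ => ⟨hγ₀, le_rfl⟩) 0 le_rfl
  exact (abs_nonneg _).trans h

end Generic

/-! ## §1  θ-generic: both history clauses of row `bg` along every windowed run of a Stage-13 parameter from the RUN-WISE letter at level `θ.γ ≤ ½` -/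

section ThetaGeneric

variable {F : T4Family} {N : ℕ} [NeZero N]

/-- **★ (hcomp) ∧ (hcompRev) AT A GENERIC `θ : Stage13Params F N` FROM THE RUN-WISE LETTER `RunConstRemainder β₁₃(θ) 0 β′ θ.γ`** (`θ.γ ≤ ½`, `p₀ = 1`, `0 ≤ A₀`, `0 ≤ cR`, letter
`β′·θ.γ² ≤ ¾`; `gOfRecord₁₃ θ p = genSeq β₁₃(θ) g₀(p)`): for every run `p`, `n ≤ K`, history in the window up to `n`, and `m < n`: `cR·ε_m ≤ 2·(cR·ε_{m+1})` and `cR·ε_{m+1} ≤ 2·(cR·ε_m)`.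
The run-wise twin of `Node00.Stage13Params.hcompBoth_of_betaBoxSignFree`; neither the sign of β nor any value of β OFF the runs is among the hypotheses.  CONDITIONAL.
[cite: Balaban1988Convergent, (2.4) p.255, (2.6)–(2.8) pp.255–256; Balaban1987RG1, (0.20) p.256, Thm 3 p.264] -/
theorem hcompBoth_of_runConstRemainder (θ : Stage13Params F N) (hA : 0 ≤ θ.ν.A₀) (hp : θ.ν.p₀ = 1) (hγ : θ.γ ≤ 1 / 2) (hcR : 0 ≤ θ.s2.cR)
    {β' : ℝ} (hR : RunConstRemainder (betaOfRecord₁₃ F N θ) (fun _ => 0) β' θ.γ) (hu : β' * θ.γ ^ 2 ≤ 3 / 4) :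
    (∀ (p : B12.RunParams) (n : ℕ), n ≤ p.K → Step.InInterval θ.γ n (gOfRecord₁₃ F N θ p) → ∀ m, m < n →
      θ.s2.cR * epsOfRecord θ.ν (gOfRecord₁₃ F N θ p) m ≤ 2 * (θ.s2.cR * epsOfRecord θ.ν (gOfRecord₁₃ F N θ p) (m + 1))) ∧
    (∀ (p : B12.RunParams) (n : ℕ), n ≤ p.K → Step.InInterval θ.γ n (gOfRecord₁₃ F N θ p) → ∀ m, m < n →
      θ.s2.cR * epsOfRecord θ.ν (gOfRecord₁₃ F N θ p) (m + 1) ≤ 2 * (θ.s2.cR * epsOfRecord θ.ν (gOfRecord₁₃ F N θ p) m)) :=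
  ⟨fun _ _ _ hw => hcomp_mul_of_hcomp θ.ν hcR (hcompBoth_genSeq_of_runConstRemainder θ.ν hp hA hw hγ hR hu).1,
    fun _ _ _ hw => hcompRev_mul_of_hcompRev θ.ν hcR (hcompBoth_genSeq_of_runConstRemainder θ.ν hp hA hw hγ hR hu).2⟩

end ThetaGeneric

/-! ## §2  At the windowed collared witness `θ₁₅ᶜᶜᴹ(j; γ)`: the CCM → CCMW transfer ALONG RUNS and both clauses from the run-wise letter of A1's witness `θ₁₅ᶜᶜᴹ(j)` -/

section AtWitnessW

variable {F : T4Family} {N : ℕ} [NeZero N] {j : ℕ} {γ ε₀ ε₂₉ B₃ B₃' a₀ a₁ : ℝ}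

/-- **A RUN-WISE LETTER OF A1's WITNESS AT LEVEL `γ ≤ ½` IS ONE OF THE WINDOW EDITION `θ₁₅ᶜᶜᴹ(j; γ)`**: along a solution of (0.20) staying in `]0, γ]` every prefix lies in
`]0, γ]^{k+1}`, where the two witnesses' β-functions of record COINCIDE (A2ʷ `betaOfRecord₁₃_theta13OfThm1CCMW_eq_of_mem`), so the run is a solution for BOTH β's and the letter
transfers verbatim (any centre `b`, any radius `r`). [cite: Balaban1987RG1, (1.20)–(1.22) p.264, (0.20) p.256, Thm 3 p.264 (bookkeeping)] -/
theorem runConstRemainder_theta13OfThm1CCMW_of_half (hγ : γ ≤ 1 / 2) {b : ℕ → ℝ} {r : ℝ}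
    (h : RunConstRemainder (betaOfRecord₁₃ F N (theta13OfThm1CCM F N j ε₀ ε₂₉ B₃ B₃' a₀ a₁)) b r γ) :
    RunConstRemainder (betaOfRecord₁₃ F N (theta13OfThm1CCMW F N j γ ε₀ ε₂₉ B₃ B₃' a₀ a₁)) b r γ := by
  intro n gs hrg hI k hk
  have hbox : ∀ k', k' ≤ n → prefixOf gs k' ∈ Box γ k' := fun k' hk' =>
    mem_box.mpr fun i => hI i ((Nat.lt_succ_iff.mp i.isLt).trans hk')
  have hrg' : RGEqH n (betaOfRecord₁₃ F N (theta13OfThm1CCM F N j ε₀ ε₂₉ B₃ B₃' a₀ a₁)) gs := fun k' hk' => by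
    rw [← betaOfRecord₁₃_theta13OfThm1CCMW_eq_of_mem (j := j) (γ := γ) hγ (hbox k' hk'.le)]
    exact hrg k' hk'
  rw [betaOfRecord₁₃_theta13OfThm1CCMW_eq_of_mem hγ (hbox k hk)]
  exact h n gs hrg' hI k hk

/-- **★ (hcomp) ∧ (hcompRev) AT `θ₁₅ᶜᶜᴹ(j; γ)` FROM THE RUN-WISE LETTER OF A1's WITNESS `β₁₃(θ₁₅ᶜᶜᴹ(j))` AT LEVEL `γ ≤ ½`** (`RunConstRemainder β₁₃(θ₁₅ᶜᶜᴹ(j)) 0 β′ γ`, letter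
`β′·γ² ≤ ¾`; weak signs of the class constants; `θ₁₅ᶜᶜᴹ(j; γ).γ = γ`, `p₀ = 1`, `cR = 1`, `A₀ = A₀ᶜᶜ¹ ≥ 0` by A1ʷ's `rfl` lemmas) — §2's transfer then §1.  The run-wise twin of Dʷ
`hcompBoth_theta13OfThm1CCMW_of_betaBoxSignFree_half`.  CONDITIONAL on the displayed letter. [cite: Balaban1988Convergent, (2.4) p.255, (2.6)–(2.8) pp.255–256; Balaban1987RG1, (0.20) p.256, (1.20)–(1.22) p.264, Thm 3 p.264] -/
theorem hcompBoth_theta13OfThm1CCMW_of_runConstRemainder_half (hγ : γ ≤ 1 / 2) (hB : 0 ≤ B₃) (hB' : 0 ≤ B₃') (ha₀ : 0 ≤ a₀) (ha₁ : 0 ≤ a₁) {β' : ℝ}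
    (hR : RunConstRemainder (betaOfRecord₁₃ F N (theta13OfThm1CCM F N j ε₀ ε₂₉ B₃ B₃' a₀ a₁)) (fun _ => 0) β' γ) (hu : β' * γ ^ 2 ≤ 3 / 4) :
    (∀ (p : B12.RunParams) (n : ℕ), n ≤ p.K → Step.InInterval (theta13OfThm1CCMW F N j γ ε₀ ε₂₉ B₃ B₃' a₀ a₁).γ n (gOfRecord₁₃ F N (theta13OfThm1CCMW F N j γ ε₀ ε₂₉ B₃ B₃' a₀ a₁) p) → ∀ m, m < n →
      (theta13OfThm1CCMW F N j γ ε₀ ε₂₉ B₃ B₃' a₀ a₁).s2.cR * epsOfRecord (theta13OfThm1CCMW F N j γ ε₀ ε₂₉ B₃ B₃' a₀ a₁).ν (gOfRecord₁₃ F N (theta13OfThm1CCMW F N j γ ε₀ ε₂₉ B₃ B₃' a₀ a₁) p) m ≤ 2 * ((theta13OfThm1CCMW F N j γ ε₀ ε₂₉ B₃ B₃' a₀ a₁).s2.cR * epsOfRecord (theta13OfThm1CCMW F N j γ ε₀ ε₂₉ B₃ B₃' a₀ a₁).ν (gOfRecord₁₃ F N (theta13OfThm1CCMW F N j γ ε₀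 ε₂₉ B₃ B₃' a₀ a₁) p) (m + 1))) ∧
    (∀ (p : B12.RunParams) (n : ℕ), n ≤ p.K → Step.InInterval (theta13OfThm1CCMW F N j γ ε₀ ε₂₉ B₃ B₃' a₀ a₁).γ n (gOfRecord₁₃ F N (theta13OfThm1CCMW F N j γ ε₀ ε₂₉ B₃ B₃' a₀ a₁) p) → ∀ m, m < n →
      (theta13OfThm1CCMW F N j γ ε₀ ε₂₉ B₃ B₃' a₀ a₁).s2.cR * epsOfRecord (theta13OfThm1CCMW F N j γ ε₀ ε₂₉ B₃ B₃' a₀ a₁).ν (gOfRecord₁₃ F N (theta13OfThm1CCMW F N j γ ε₀ ε₂₉ B₃ B₃' a₀ a₁) p) (m + 1) ≤ 2 * ((theta13OfThm1CCMW F N j γ ε₀ ε₂₉ B₃ B₃' a₀ a₁).s2.cR * epsOfRecord (theta13OfThm1CCMW F N j γ ε₀ ε₂₉ B₃ B₃' a₀ a₁).ν (gOfRecord₁₃ F N (theta13OfThm1CCMW F N j γ ε₀ ε₂₉ B₃ B₃' a₀ a₁) p) m)) := by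
  have hγ' := theta13OfThm1CCMW_γ F N j γ ε₀ ε₂₉ B₃ B₃' a₀ a₁
  refine hcompBoth_of_runConstRemainder (theta13OfThm1CCMW F N j γ ε₀ ε₂₉ B₃ B₃' a₀ a₁) (β' := β')
    (by rw [theta13OfThm1CCMW_A₀]; exact A0OfThm1CC1_nonneg hB hB' ha₀ ha₁) (theta13OfThm1CCMW_p₀ F N j γ ε₀ ε₂₉ B₃ B₃' a₀ a₁) (by rw [hγ']; exact hγ)
    (by rw [theta13OfThm1CCMW_cR]; norm_num) ?_ ?_
  · rw [hγ']; exact runConstRemainder_theta13OfThm1CCMW_of_half hγ hR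
  · rw [hγ']; exact hu

end AtWitnessW

/-! ## §3  ★ ONE run-wise letter of `θ₁₅ᶜᶜᴹ(j)` ⟹ the sign-free clauses at `θ₁₅ᶜᶜᴹᵂ(j; γ)`; K0⁷'s body at `F` at the cube letter `(L^j, c)` -/

section Body

variable (F : T4Family) (j : ℕ) {B₃ B₃' a₀ a₁ : ℝ}

/-- **★ ONE RUN-WISE LETTER ⟹ THE SIGN-FREE CLAUSES, AT ANY INDEX `j`** (PART 1 `clausesH_of_absBox` with the box replaced by the runs): a run-wise letter
`RunConstRemainder β₁₃(θ₁₅ᶜᶜᴹ(j; ε₀, ε₂₉)) 0 β′ γ₀` on some level `γ₀ > 0` (thresholds chosen with it) gives, for `0 ≤ B₃, B₃′, a₀, a₁`, a window `γ ∈ ]0, ½]`, `γ ≤ γ₀`, with (hcomp) ∧ (hcompRev)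
along every `γ`-windowed run of `θ₁₅ᶜᶜᴹᵂ(j; γ)` — `0 ≤ β′` read off the one-point run, the window shrink `exists_window_letters_signFree`, the level restriction `RunConstRemainder.mono`, then §2.
No (8)∕(9) token is read.  CONDITIONAL on the letter. [cite: Balaban1987RG1, Thm 1 p.259, (0.20) p.256, (1.20)–(1.22) p.264, Thm 3 p.264; Balaban1988Convergent, (2.4)–(2.8) pp.255–256] -/
theorem clausesH_of_runAbsBox (hB : 0 ≤ B₃) (hB' : 0 ≤ B₃') (ha₀ : 0 ≤ a₀) (ha₁ : 0 ≤ a₁)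
    (h : ∃ γ₀ ε₀ ε₂₉ β' : ℝ, 0 < γ₀ ∧ 0 < ε₀ ∧ 0 < ε₂₉ ∧
        RunConstRemainder (betaOfRecord₁₃ F 2 (theta13OfThm1CCM F 2 j ε₀ ε₂₉ B₃ B₃' a₀ a₁)) (fun _ => 0) β' γ₀) :
    ∃ γ ε₀ ε₂₉ : ℝ, 0 < γ ∧ γ ≤ 1 / 2 ∧ 0 < ε₀ ∧ 0 < ε₂₉ ∧
        (∀ (p : B12.RunParams) (n : ℕ), n ≤ p.K → Step.InInterval (theta13OfThm1CCMW F 2 j γ ε₀ ε₂₉ B₃ B₃' a₀ a₁).γ n (gOfRecord₁₃ F 2 (theta13OfThm1CCMW F 2 j γ ε₀ ε₂₉ B₃ B₃' a₀ a₁) p) → ∀ m, m < n →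
          (theta13OfThm1CCMW F 2 j γ ε₀ ε₂₉ B₃ B₃' a₀ a₁).s2.cR * epsOfRecord (theta13OfThm1CCMW F 2 j γ ε₀ ε₂₉ B₃ B₃' a₀ a₁).ν (gOfRecord₁₃ F 2 (theta13OfThm1CCMW F 2 j γ ε₀ ε₂₉ B₃ B₃' a₀ a₁) p) m ≤
            2 * ((theta13OfThm1CCMW F 2 j γ ε₀ ε₂₉ B₃ B₃' a₀ a₁).s2.cR * epsOfRecord (theta13OfThm1CCMW F 2 j γ ε₀ ε₂₉ B₃ B₃' a₀ a₁).ν (gOfRecord₁₃ F 2 (theta13OfThm1CCMW F 2 j γ ε₀ ε₂₉ B₃ B₃' a₀ a₁) p) (m + 1))) ∧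
        (∀ (p : B12.RunParams) (n : ℕ), n ≤ p.K → Step.InInterval (theta13OfThm1CCMW F 2 j γ ε₀ ε₂₉ B₃ B₃' a₀ a₁).γ n (gOfRecord₁₃ F 2 (theta13OfThm1CCMW F 2 j γ ε₀ ε₂₉ B₃ B₃' a₀ a₁) p) → ∀ m, m < n →
          (theta13OfThm1CCMW F 2 j γ ε₀ ε₂₉ B₃ B₃' a₀ a₁).s2.cR * epsOfRecord (theta13OfThm1CCMW F 2 j γ ε₀ ε₂₉ B₃ B₃' a₀ a₁).ν (gOfRecord₁₃ F 2 (theta13OfThm1CCMW F 2 j γ ε₀ ε₂₉ B₃ B₃' a₀ a₁) p) (m + 1) ≤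
            2 * ((theta13OfThm1CCMW F 2 j γ ε₀ ε₂₉ B₃ B₃' a₀ a₁).s2.cR * epsOfRecord (theta13OfThm1CCMW F 2 j γ ε₀ ε₂₉ B₃ B₃' a₀ a₁).ν (gOfRecord₁₃ F 2 (theta13OfThm1CCMW F 2 j γ ε₀ ε₂₉ B₃ B₃' a₀ a₁) p) m)) := by
  obtain ⟨γ₀, ε₀, ε₂₉, β', hγ0, hε, hε', hR⟩ := h
  have hβ' : 0 ≤ β' := nonneg_of_runConstRemainder_zero hγ0 hR
  obtain ⟨γ, hγpos, hγle, hγhalf, -, hu⟩ := exists_window_letters_signFree hγ0 hβ'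
  exact ⟨γ, ε₀, ε₂₉, hγpos, hγhalf, hε, hε',
    hcompBoth_theta13OfThm1CCMW_of_runConstRemainder_half hγhalf hB hB' ha₀ ha₁ (hR.mono hγle) hu⟩

variable {j} {c : ℕ}

/-- **★ THE ⁷ K0 BODY FOR `F` AT AN ARBITRARY CUBE LETTER FROM (8), THE (9)-TOKEN AND ONE RUN-WISE LETTER** — `N = 2`, `M = M₁ = L^j`, (9)-floor `c ≤ L^j`, on EVERY family: from the
guarded tuple `(B₃, B₉, a₀, a₁)` carrying [15] Thm 1's (8)-sentence `VariationalThm1RegSepCoP7M` and the floor-carrying (9)-token `Gauge9RegSepTopStepR … (L^j) c`, and the RUN-WISE letter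
`RunConstRemainder β₁₃(θ₁₅ᶜᶜᴹ(j)) 0 β′ γ₀` for THAT tuple, the body follows: `clausesH_of_runAbsBox` gives (hcomp) ∧ (hcompRev) at `θ₁₅ᶜᶜᴹᵂ(j; γ)` and the all-torus closer
`exists_k0SepCoPH_thm1CCMW_of_gauge9TopStepR_of_hcomp_allTorus` (p575996, generic `(j, c)`) gives the body.  PART 1 §2's twin with 3ᴬ′'s clause replaced by 3ᴿ's.  CONDITIONAL.
[cite: Balaban1985Variational, Thm 1 (8)–(9) p.279, (144)–(152) pp.300–301, Prop. 8 p.304; Balaban1988Convergent, Thm 1 p.262, (2.6)–(2.8) pp.255–256, p.257, (2.21) p.258; Balaban1987RG1, Thm 1 p.259, (1.12) p.262, Thm 3 p.264] -/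
theorem exists_k0H_of_thm1CoP7M_of_gauge9R_of_runAbsBox (hc : c ≤ F.L ^ j) {B₃ B₉ a₀ a₁ : ℝ} (hB₃ : 0 ≤ B₃) (hB₉ : 0 ≤ B₉)
    (ha₀ : 0 < a₀) (ha₁ : 0 < a₁) (h15 : VariationalThm1RegSepCoP7M F 2 B₃ a₀ a₁)
    (h9 : Gauge9RegSepTopStepR F 2 (fun ν K Ω => suppDomOfRecord F ν K Ω) (F.L ^ j) c B₃ B₉ a₀ a₁)
    (h3R : ∃ γ₀ ε₀ ε₂₉ β' : ℝ, 0 < γ₀ ∧ 0 < ε₀ ∧ 0 < ε₂₉ ∧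
        RunConstRemainder (betaOfRecord₁₃ F 2 (theta13OfThm1CCM F 2 j ε₀ ε₂₉ B₃ B₉ a₀ a₁)) (fun _ => 0) β' γ₀) :
    ∃ θ : Stage13HParams F 2, θ.Provisos₁₃SepCoPH F 2 ∧ (θ.ZhUnity F 2 ∧ θ.SlotsNondegenerate₁₃ F 2) ∧ θ.Admissible F 2 := by
  obtain ⟨γ, ε₀, ε₂₉, hγ0, hγ, hε, hε', hcomp, hcompRev⟩ := clausesH_of_runAbsBox F j hB₃ hB₉ ha₀.le ha₁.le h3R
  exact exists_k0SepCoPH_thm1CCMW_of_gauge9TopStepR_of_hcomp_allTorus F hγ0 hγ hε hε' hB₃ hB₉ ha₀ ha₁ h15 hc h9 hcomp hcompRev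

end Body

/-! ## §4  Stub level: K0⁷ BY NAME from the texts of stubs 1, 2′ and the RUN-WISE face 3ᴿ; 3ᴬ′ ⟹ 3ᴿ; V19's composition factors through 3ᴿ -/

section Stubs

/-- **★★ K0⁷'s BODY AT EVERY FAMILY FROM STUB 1, A GENERIC (9)-SUPPLIER, AND 3ᴿ** — PART 1 §3 `record13SepCoPHBody_of_stub1_of_gauge9Supplier_of_absBetaBoxAt` with `h3A'` (box)
replaced by `h3R` (runs): `h1` = stub 1's text; `hS` = the generic (9)-supplier («SOME cube letter `(j, c)` with `c ≤ L^j`, some `B₉ > 0` and a ceiling `0 < a₁′ ≤ a₁` carry the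
(9)-token», PART 2 instantiates it from stub 2′); `h3R` = 3ᴿ := 3ᴬ′'s (j,c)-generic prefix VERBATIM with the RUN-WISE clause.  Proof: stub 1 ⇒ (8) at the shrunk ceiling (N07's bridge
`variationalThm1RegSepCoP7M_of_prop8TopStep`), `hS` ⇒ (9), `h3R` at that point ⇒ §3.  CONDITIONAL; K0⁷ NOT closed here; nothing of Bałaban asserted.
[cite: Balaban1985Variational, Thm 1 (8)–(9) p.279, (152) p.301, Prop. 8 p.304; Balaban1985RegularSpaces, Prop. 6 p.99, p.98; Balaban1988Convergent, Thm 1 p.262, (2.6)–(2.8) pp.255–256, p.257; Balaban1987RG1, Thm 1 p.259, Thm 3 p.264] -/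
theorem record13SepCoPHBody_of_stub1_of_gauge9Supplier_of_runAbsBetaBoxAt
    (h1 : ∀ F : T4Family, ∃ B₃ a₀ a₁ : ℝ, 2 * (F.L : ℝ) ^ 2 ≤ B₃ ∧ 0 < a₀ ∧ 0 < a₁ ∧
      Prop8RegSepTopStep F 2 (fun ν K Ω => suppDomOfRecord F ν K Ω) B₃ a₀ a₁)
    (hS : ∀ (F : T4Family) (B₃ a₀ a₁ : ℝ), 2 * (F.L : ℝ) ^ 2 ≤ B₃ → 0 < a₀ → 0 < a₁ →
      Prop8RegSepTopStep F 2 (fun ν K Ω => suppDomOfRecord F ν K Ω) B₃ a₀ a₁ →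
      ∃ (j c : ℕ) (B₉ a₁' : ℝ), c ≤ F.L ^ j ∧ 0 < B₉ ∧ 0 < a₁' ∧ a₁' ≤ a₁ ∧
        Gauge9RegSepTopStepR F 2 (fun ν K Ω => suppDomOfRecord F ν K Ω) (F.L ^ j) c B₃ B₉ a₀ a₁')
    (h3R : ∀ (F : T4Family) (j c : ℕ) (B₃ B₃' a₀ a₁ : ℝ), c ≤ F.L ^ j → 2 * (F.L : ℝ) ^ 2 ≤ B₃ → 0 < B₃' → 0 < a₀ → 0 < a₁ →
      VariationalThm1RegSepCoP7M F 2 B₃ a₀ a₁ →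
      Gauge9RegSepTopStepR F 2 (fun ν K Ω => suppDomOfRecord F ν K Ω) (F.L ^ j) c B₃ B₃' a₀ a₁ →
      ∃ γ₀ ε₀ ε₂₉ β' : ℝ, 0 < γ₀ ∧ 0 < ε₀ ∧ 0 < ε₂₉ ∧
        RunConstRemainder (betaOfRecord₁₃ F 2 (theta13OfThm1CCM F 2 j ε₀ ε₂₉ B₃ B₃' a₀ a₁)) (fun _ => 0) β' γ₀) :
    ∀ F : T4Family, ∃ θ : Stage13HParams F 2, θ.Provisos₁₃SepCoPH F 2 ∧ (θ.ZhUnity F 2 ∧ θ.SlotsNondegenerate₁₃ F 2) ∧ θ.Admissible F 2 := by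
  intro F
  obtain ⟨B₃, a₀, a₁, hB₃, ha₀, ha₁, h8⟩ := h1 F
  have hL : (0 : ℝ) < (F.L : ℝ) := by exact_mod_cast lt_trans Nat.zero_lt_one F.hL.2
  have hBpos : (0 : ℝ) < B₃ := lt_of_lt_of_le (mul_pos two_pos (pow_pos hL 2)) hB₃
  obtain ⟨j, c, B₉, a₁', hc, hB₉, ha₁', ha₁'le, h9⟩ := hS F B₃ a₀ a₁ hB₃ ha₀ ha₁ h8
  have h15 : VariationalThm1RegSepCoP7M F 2 B₃ a₀ a₁' := variationalThm1RegSepCoP7M_of_prop8TopStep hBpos (h8.of_le le_rfl ha₁'le)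
  exact exists_k0H_of_thm1CoP7M_of_gauge9R_of_runAbsBox F hc hBpos.le hB₉.le ha₀ ha₁' h15 h9 (h3R F j c B₃ B₉ a₀ a₁' hc hB₃ hB₉ ha₀ ha₁' h15 h9)

/-- **★★ K0⁷ BY NAME FROM THE TEXTS OF STUBS 1, 2′ AND THE RUN-WISE FACE 3ᴿ** — `h1` = `K0V19Defs.Prop8StepCoPAt` (stub 1's registered text), `h2P` = `K0V19Defs.Prop6MemberB8AtP` (stub 2′'s),
`h3R` = 3ᴿ (3ᴬ′'s (j,c)-generic prefix VERBATIM, RUN-WISE clause `RunConstRemainder β₁₃(θ₁₅ᶜᶜᴹ(j)) 0 β′ γ₀`); PART 2's `gauge9Supplier_of_prop6MemberP` fills the supplier slot at the cube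
letter `(L^(ρ₀+3), (44 + 4ρ₀L)·L)`.  = PART 2's `record13SepCoPHBody_of_stubs1_2P_3A'` ∕ `K0V19Defs.record13SepCoPHInhabited_of_stubTexts` with 3ᴬ′ WEAKENED to 3ᴿ.  CONDITIONAL on the three
texts (none proved here); K0⁷ OPEN; V19 STANDS (3ᴿ is a displayed hypothesis, not a registered stub).
[cite: Balaban1985Variational, Thm 1 (8)–(9) p.279, (144)–(152) pp.300–301, Prop. 8 p.304; Balaban1985RegularSpaces, Prop. 6 p.99, p.98; Balaban1988Convergent, Thm 1 p.262, (2.6)–(2.8) pp.255–256; Balaban1987RG1, Thm 1 p.259, Thm 3 p.264, §1 p.264] -/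
theorem record13SepCoPHInhabited_of_stub1_stub2P_run3R (h1 : ∀ F : T4Family, Prop8StepCoPAt F) (h2P : ∀ F : T4Family, Prop6MemberB8AtP F)
    (h3R : ∀ (F : T4Family) (j c : ℕ) (B₃ B₃' a₀ a₁ : ℝ), c ≤ F.L ^ j → 2 * (F.L : ℝ) ^ 2 ≤ B₃ → 0 < B₃' → 0 < a₀ → 0 < a₁ →
      VariationalThm1RegSepCoP7M F 2 B₃ a₀ a₁ →
      Gauge9RegSepTopStepR F 2 (fun ν K Ω => suppDomOfRecord F ν K Ω) (F.L ^ j) c B₃ B₃' a₀ a₁ →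
      ∃ γ₀ ε₀ ε₂₉ β' : ℝ, 0 < γ₀ ∧ 0 < ε₀ ∧ 0 < ε₂₉ ∧
        RunConstRemainder (betaOfRecord₁₃ F 2 (theta13OfThm1CCM F 2 j ε₀ ε₂₉ B₃ B₃' a₀ a₁)) (fun _ => 0) β' γ₀) :
    Summit.QuantumFields.YangMills.Theses.BalabanUVNodes.Record13SepCoPHInhabited :=
  record13SepCoPHBody_of_stub1_of_gauge9Supplier_of_runAbsBetaBoxAt h1 (fun F => gauge9Supplier_of_prop6MemberP F (h2P F)) h3R

/-- **★★★ K0⁷ BY NAME FROM STUB 1's TEXT AND 3ᴿ ALONE** — stub 2′ is DISCHARGED BY NAME (`K0V19Stub2Prime.stub_prop6MemberB8AtP13`, p595104).  So on the run-wise road the open K0⁷ bill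
reads {stub 1 ([15] Prop. 8's top step, N07 ∕ k0-s1), 3ᴿ (NODE O, run-wise)}.  CONDITIONAL on those two texts — displayed, NOT inhabited here; K0⁷ OPEN.
[cite: Balaban1985Variational, Thm 1 (8)–(9) p.279, Prop. 8 p.304; Balaban1985RegularSpaces, Prop. 6 p.99; Balaban1988Convergent, Thm 1 p.262; Balaban1987RG1, Thm 1 p.259, Thm 3 p.264, §1 p.264] -/
theorem record13SepCoPHInhabited_of_stub1_run3R_byName (h1 : ∀ F : T4Family, Prop8StepCoPAt F)
    (h3R : ∀ (F : T4Family) (j c : ℕ) (B₃ B₃' a₀ a₁ : ℝ), c ≤ F.L ^ j → 2 * (F.L : ℝ) ^ 2 ≤ B₃ → 0 < B₃' → 0 < a₀ → 0 < a₁ →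
      VariationalThm1RegSepCoP7M F 2 B₃ a₀ a₁ →
      Gauge9RegSepTopStepR F 2 (fun ν K Ω => suppDomOfRecord F ν K Ω) (F.L ^ j) c B₃ B₃' a₀ a₁ →
      ∃ γ₀ ε₀ ε₂₉ β' : ℝ, 0 < γ₀ ∧ 0 < ε₀ ∧ 0 < ε₂₉ ∧
        RunConstRemainder (betaOfRecord₁₃ F 2 (theta13OfThm1CCM F 2 j ε₀ ε₂₉ B₃ B₃' a₀ a₁)) (fun _ => 0) β' γ₀) :
    Summit.QuantumFields.YangMills.Theses.BalabanUVNodes.Record13SepCoPHInhabited :=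
  record13SepCoPHInhabited_of_stub1_stub2P_run3R h1 stub_prop6MemberB8AtP13 h3R

/-- **3ᴬ′ ⟹ 3ᴿ AT ONE FAMILY** (box ⟹ runs, `runConstRemainder_zero_of_absBox`; the same thresholds, window and bound): the REGISTERED socket PAYS the run-wise face.  The converse is NOT
claimed. [cite: Balaban1987RG1, Thm 1 p.259, §1 p.264, Thm 3 p.264 (bookkeeping)] -/
theorem run3R_of_abs3A' (F : T4Family) (h : AbsBetaBoxAtThm1WitnessCCMGenAt F) :
    ∀ (j c : ℕ) (B₃ B₃' a₀ a₁ : ℝ), c ≤ F.L ^ j → 2 * (F.L : ℝ) ^ 2 ≤ B₃ → 0 < B₃' → 0 < a₀ → 0 < a₁ →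
      VariationalThm1RegSepCoP7M F 2 B₃ a₀ a₁ →
      Gauge9RegSepTopStepR F 2 (fun ν K Ω => suppDomOfRecord F ν K Ω) (F.L ^ j) c B₃ B₃' a₀ a₁ →
      ∃ γ₀ ε₀ ε₂₉ β' : ℝ, 0 < γ₀ ∧ 0 < ε₀ ∧ 0 < ε₂₉ ∧
        RunConstRemainder (betaOfRecord₁₃ F 2 (theta13OfThm1CCM F 2 j ε₀ ε₂₉ B₃ B₃' a₀ a₁)) (fun _ => 0) β' γ₀ := by
  intro j c B₃ B₃' a₀ a₁ hc hB₃ hB₃' ha₀ ha₁ h15 h9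
  obtain ⟨γ₀, ε₀, ε₂₉, β', hγ0, hε, hε', hlow, hup⟩ := h j c B₃ B₃' a₀ a₁ hc hB₃ hB₃' ha₀ ha₁ h15 h9
  exact ⟨γ₀, ε₀, ε₂₉, β', hγ0, hε, hε', runConstRemainder_zero_of_absBox hlow hup⟩

/-- **SANITY — V19's BY-NAME COMPOSITION FACTORS THROUGH 3ᴿ**: the three registered texts give K0⁷ through the run-wise road (`run3R_of_abs3A'` then ★★), i.e. this file's road is
not stronger in its demands than the skeleton's.  CONDITIONAL; nothing asserted. [cite: Balaban1987RG1, Thm 1 p.259, §1 p.264 (bookkeeping)] -/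
theorem record13SepCoPHInhabited_of_stubTexts_via_run3R (h1 : ∀ F : T4Family, Prop8StepCoPAt F) (h2P : ∀ F : T4Family, Prop6MemberB8AtP F)
    (h3A' : ∀ F : T4Family, AbsBetaBoxAtThm1WitnessCCMGenAt F) :
    Summit.QuantumFields.YangMills.Theses.BalabanUVNodes.Record13SepCoPHInhabited :=
  record13SepCoPHInhabited_of_stub1_stub2P_run3R h1 h2P fun F => run3R_of_abs3A' F (h3A' F)

/-- sanity (kernel): K0⁷ is literally `∀ F, K0HBodyAt F`, so ★★'s conclusion is the body at every family. [cite: Balaban1988Convergent, Thm 1 p.262 (bookkeeping)] -/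
example : Summit.QuantumFields.YangMills.Theses.BalabanUVNodes.Record13SepCoPHInhabited ↔ ∀ F : T4Family, K0HBodyAt F := Iff.rfl

end Stubs

end Summit.QuantumFields.YangMills.Theorems.K0Stub3RunwiseFace

end
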